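import Mathlib
import Summits.NavierStokesRegularity.NavierStokesRegularity.Theorems.LerayQuarterDissipationFiniteDissipationLiouvilleWindowSocket
import HarnessLib

/-!
# Crux `FiniteDissipationLiouville` (stmt-NavierStokesRegularity-22144): THE WINDOW SOCKET WITH A
# COLLAR — violations BY A DEFINITE MARGIN recur with bounded gaps and fill a definite volume

Theorems file of route `LerayQuarterDissipation` (lead prover g19; `--supports` the crux; sequel of
`…WindowSocket`). Navier–Stokes regularity is NOT proved by anything here; no summit is.

`…WindowSocket` turns an apex criterion «`G` on a final slab ⇒ not singular» into «every singular
member violates `G` in every window `[−c², −εc²]`, on a set of definite volume». Lead g18's COLLAR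
lemma (`…LambProduct.exists_gap_of_closed`) turns an all-time criterion at threshold `θ₀` into one
at threshold `θ₀ + ε`. This file does both at once: for a ONE-PARAMETER FAMILY `G θ` of pointwise
hypotheses (threshold `θ`), scale covariant for each `θ`, such that a violation of `G θ₀` by a KNSS
limit `W` at `(t,x)` forces violations of `G θ_j` by the approximants `u_j` at `(t,x)` for all
large `j` whenever `θ_j → θ₀` (the violation set is open JOINTLY in the field and the threshold),
with the apex kill at `θ₀` («`G θ₀ W` on `(−1,0) × ℝ³ ⇒ W` not singular»):

* **`exists_window_margin_of_apex_kill`** — there are `ε ∈ (0,1)` and a MARGIN `δ > 0` such that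
  every singular member of the frame (Type-I `C`, law `K`, side class `Q`) violates `G (θ₀ + δ)`
  at some point of EVERY window `[−c², −εc²] × ℝ³`;
* **`exists_window_margin_volume_of_apex_kill`** — if the violation sets `{(t,x) : t<0, ¬G θ U t x}`
  are open, there are `ε ∈ (0,1)`, `δ > 0`, `η > 0` such that the violation set OF `G (θ₀ + δ)` of
  every singular member meets the unit window in volume `≥ η`;
* `…_envelope` forms on the enveloped frame (law supplied by `…LambProduct.exists_uniform_law_of_envelope`).

Instances (sequel `…WindowCollar`): the super-self-similar speed BY A MARGIN, `√(−t)‖u‖ > 1 + δ(A)`,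
and the local production excess BY A FACTOR `1 + δ(A)`, recur with bounded gaps on sets of definite
volume — merging g18's collar portraits («by a definite amount, somewhere») with the window
portraits of `…WindowRecurrence` («in every window, definite volume»).

Proof: as in `…WindowSocket` with thresholds `θ₀ + 1/(j+2)` along the contradiction sequence; the
limit satisfies `G θ₀` on `(−1,0) × ℝ³` because a violation there would propagate to the
approximants at their own (moving) thresholds.

HONEST FRAMING. One more compactness corollary (ineffective `ε, δ, η`) about a HYPOTHETICAL object.
Nothing is removed from the catalogued DSS wall (`∀ c>1 TypeIDSSLiouville c`, NECESSARY for the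
crux). Nothing here bears on Navier–Stokes regularity.

References: Koch–Nadirashvili–Seregin–Šverák, Acta Math. 203 (2009) §4; folklore.
-/

noncomputable section

set_option linter.dupNamespace false

namespace Summit.NavierStokesRegularity.NavierStokesRegularity.Theorems.FiniteDissipationLiouville.WindowSocket

open MeasureTheory Set Filter Topology Metric Function Real
open scoped ENNReal
open Literature.Analysis Literature.Analysis.FluidPDE
open Summit.NavierStokesRegularity.NavierStokesRegularity.Theorems
open Summit.NavierStokesRegularity.NavierStokesRegularity.Theorems.RecurrentReductionD
open Summit.NavierStokesRegularity.NavierStokesRegularity.Theorems.FiniteDissipationLiouville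
open Summit.NavierStokesRegularity.NavierStokesRegularity.Theorems.FiniteDissipationLiouville.LambProduct

variable {C K : ℝ}

/-- Along `ψ → ∞`, `θ₀ + 1/(ψ j + 2) → θ₀`. [folklore] -/
theorem tendsto_theta_seq {ψ : ℕ → ℕ} (hψ : Tendsto ψ atTop atTop) (θ₀ : ℝ) :
    Tendsto (fun j => θ₀ + (1 : ℝ) / ((ψ j : ℝ) + 2)) atTop (𝓝 θ₀) := by
  have h := (tendsto_eps_seq hψ).const_add θ₀
  rwa [add_zero] at h

/-- **THE WINDOW SOCKET WITH A COLLAR (point form).** See the module docstring.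
[folklore compactness; cite: KochNadirashviliSereginSverak2009, §4 (arXiv:0709.3599 p. 8)] -/
theorem exists_window_margin_of_apex_kill {θ₀ : ℝ}
    {Q : (ℝ → EuclideanSpace ℝ (Fin 3) → EuclideanSpace ℝ (Fin 3)) → Prop}
    {G : ℝ → (ℝ → EuclideanSpace ℝ (Fin 3) → EuclideanSpace ℝ (Fin 3)) → ℝ → EuclideanSpace ℝ (Fin 3) → Prop}
    (hQscale : ∀ (V : (ℝ → EuclideanSpace ℝ (Fin 3) → EuclideanSpace ℝ (Fin 3))) (c : ℝ), 0 < c →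
      Q V → Q (nsRescale c V))
    (hQclosed : ∀ (u : ℕ → (ℝ → EuclideanSpace ℝ (Fin 3) → EuclideanSpace ℝ (Fin 3)))
        (W : (ℝ → EuclideanSpace ℝ (Fin 3) → EuclideanSpace ℝ (Fin 3))),
      (∀ j, IsTypeIAncientMild C (u j)) → (∀ j, Q (u j)) → IsTypeIAncientMild C W →
      (∀ n : ℕ, TendstoUniformlyOn (fun j z => u j z.1 z.2) (fun z => W z.1 z.2) atTop
        (Icc (-((n : ℝ) + 2)) (-(1 / ((n : ℝ) + 2))) ×ˢ
          closedBall (0 : EuclideanSpace ℝ (Fin 3)) ((n : ℝ) + 2))) →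
      (∀ t < 0, ∀ x, Tendsto (fun j => u j t x) atTop (𝓝 (W t x))) →
      (∀ t < 0, ∀ x, Tendsto (fun j => fderiv ℝ (u j t) x) atTop (𝓝 (fderiv ℝ (W t) x))) →
      Q W)
    (hGscale : ∀ (θ : ℝ) (V : (ℝ → EuclideanSpace ℝ (Fin 3) → EuclideanSpace ℝ (Fin 3))) (c t : ℝ)
      (x : EuclideanSpace ℝ (Fin 3)), 0 < c → t < 0 → G θ V (c ^ 2 * t) (c • x) → G θ (nsRescale c V) t x)
    (hGev : ∀ (u : ℕ → (ℝ → EuclideanSpace ℝ (Fin 3) → EuclideanSpace ℝ (Fin 3)))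
        (W : (ℝ → EuclideanSpace ℝ (Fin 3) → EuclideanSpace ℝ (Fin 3))) (θ : ℕ → ℝ),
      (∀ j, IsTypeIAncientMild C (u j)) → IsTypeIAncientMild C W →
      (∀ n : ℕ, TendstoUniformlyOn (fun j z => u j z.1 z.2) (fun z => W z.1 z.2) atTop
        (Icc (-((n : ℝ) + 2)) (-(1 / ((n : ℝ) + 2))) ×ˢ
          closedBall (0 : EuclideanSpace ℝ (Fin 3)) ((n : ℝ) + 2))) →
      (∀ t < 0, ∀ x, Tendsto (fun j => u j t x) atTop (𝓝 (W t x))) →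
      (∀ t < 0, ∀ x, Tendsto (fun j => fderiv ℝ (u j t) x) atTop (𝓝 (fderiv ℝ (W t) x))) →
      Tendsto θ atTop (𝓝 θ₀) →
      ∀ t < 0, ∀ x, ¬ G θ₀ W t x → ∀ᶠ j in atTop, ¬ G (θ j) (u j) t x)
    (hkill : ∀ (W : (ℝ → EuclideanSpace ℝ (Fin 3) → EuclideanSpace ℝ (Fin 3))),
      IsTypeIAncientMild C W →
      (∀ s : ℝ, s < 0 → ∫⁻ x, ‖fderiv ℝ (W s) x‖ₑ ^ 2 ≤ ENNReal.ofReal (K / Real.sqrt (-s))) →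
      Q W → (∀ t : ℝ, -1 < t → t < 0 → ∀ x, G θ₀ W t x) →
      ¬ (∀ r > 0, ∀ M : ℝ, ∃ t ∈ Ioo (-(r ^ 2)) (0 : ℝ),
        ∃ x ∈ ball (0 : EuclideanSpace ℝ (Fin 3)) r, M < ‖W t x‖)) :
    ∃ ε : ℝ, 0 < ε ∧ ε < 1 ∧ ∃ δ : ℝ, 0 < δ ∧
      ∀ (V : (ℝ → EuclideanSpace ℝ (Fin 3) → EuclideanSpace ℝ (Fin 3))), IsTypeIAncientMild C V →
        (∀ s : ℝ, s < 0 → ∫⁻ x, ‖fderiv ℝ (V s) x‖ₑ ^ 2 ≤ ENNReal.ofReal (K / Real.sqrt (-s))) →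
        Q V →
        (∀ r > 0, ∀ M : ℝ, ∃ t ∈ Ioo (-(r ^ 2)) (0 : ℝ),
          ∃ x ∈ ball (0 : EuclideanSpace ℝ (Fin 3)) r, M < ‖V t x‖) →
        ∀ c : ℝ, 0 < c → ∃ t ∈ Icc (-c ^ 2) (-(ε * c ^ 2)), ∃ x : EuclideanSpace ℝ (Fin 3),
          ¬ G (θ₀ + δ) V t x := by
  by_contra hcon
  push Not at hcon
  -- ## unit-scale windows `[−1, −ε]` on which `G (θ₀ + δ)` holds, for every `ε ∈ (0,1)`, `δ > 0`
  have hunit : ∀ ε : ℝ, 0 < ε → ε < 1 → ∀ δ : ℝ, 0 < δ →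
      ∃ u : (ℝ → EuclideanSpace ℝ (Fin 3) → EuclideanSpace ℝ (Fin 3)), IsTypeIAncientMild C u ∧
        (∀ s : ℝ, s < 0 → ∫⁻ x, ‖fderiv ℝ (u s) x‖ₑ ^ 2 ≤ ENNReal.ofReal (K / Real.sqrt (-s))) ∧
        Q u ∧
        (∀ r > 0, ∀ M : ℝ, ∃ t ∈ Ioo (-(r ^ 2)) (0 : ℝ),
          ∃ x ∈ ball (0 : EuclideanSpace ℝ (Fin 3)) r, M < ‖u t x‖) ∧
        ∀ t ∈ Icc (-1 : ℝ) (-ε), ∀ x, G (θ₀ + δ) u t x := by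
    intro ε hε hε1 δ hδ
    obtain ⟨V, hV, hlaw, hQ, hsing, c, hc, hgood⟩ := hcon ε hε hε1 δ hδ
    refine ⟨nsRescale c V, hV.nsRescale hc, dissipationLaw_nsRescale hlaw hc, hQscale V c hc hQ,
      singularAtOrigin_nsRescale hsing hc, fun t ht x => hGscale _ V c t x hc (by linarith [ht.2]) ?_⟩
    have hc2 : 0 < c ^ 2 := by positivity
    refine hgood (c ^ 2 * t) ⟨?_, ?_⟩ (c • x)
    · nlinarith [ht.1]
    · nlinarith [ht.2]
  -- ## the sequence `ε_j = δ_j = 1/(j+2)` and its KNSS limit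
  choose u hu hlaw hQu hsu hgood using fun j : ℕ => hunit (1 / ((j : ℝ) + 2)) (eps_seq_mem j).1
    (eps_seq_mem j).2 (1 / ((j : ℝ) + 2)) (eps_seq_mem j).1
  obtain ⟨ψ, hψ, W, hW, hunif, hpt, hgr⟩ := Compactness.seqLimit hu
  have hψt : Tendsto ψ atTop atTop := hψ.tendsto_atTop
  have hlawW := dissipationLaw_of_tendsto_fderiv (w := fun j => u (ψ j)) (fun j => hlaw (ψ j)) hgr
  have hQW : Q W := hQclosed (fun j => u (ψ j)) W (fun j => hu (ψ j)) (fun j => hQu (ψ j)) hW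
    hunif hpt hgr
  have hWsing := Compactness.persistent_singularity_seq (w := fun j => u (ψ j))
    (fun j => hu _) (fun j => hlaw _) (fun j => hsu _) hW hunif
  -- ## the limit satisfies `G θ₀` on `(−1, 0) × ℝ³`
  have hgoodW : ∀ t : ℝ, -1 < t → t < 0 → ∀ x, G θ₀ W t x := by
    intro t h1 ht x
    by_contra hbad
    have hev := hGev (fun j => u (ψ j)) W (fun j => θ₀ + 1 / ((ψ j : ℝ) + 2)) (fun j => hu _) hW
      hunif hpt hgr (tendsto_theta_seq hψt θ₀) t ht x hbad
    have hev2 : ∀ᶠ j in atTop, (1 : ℝ) / ((ψ j : ℝ) + 2) < -t :=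
      (tendsto_eps_seq hψt).eventually (gt_mem_nhds (neg_pos.2 ht))
    obtain ⟨j, hj1, hj2⟩ := (hev.and hev2).exists
    exact hj1 (hgood (ψ j) t ⟨h1.le, by linarith⟩ x)
  exact hkill W hW hlawW hQW hgoodW hWsing

/-- **THE WINDOW SOCKET WITH A COLLAR (volume form).** See the module docstring.
[folklore compactness; cite: KochNadirashviliSereginSverak2009, §4 (arXiv:0709.3599 p. 8)] -/
theorem exists_window_margin_volume_of_apex_kill {θ₀ : ℝ}
    {Q : (ℝ → EuclideanSpace ℝ (Fin 3) → EuclideanSpace ℝ (Fin 3)) → Prop}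
    {G : ℝ → (ℝ → EuclideanSpace ℝ (Fin 3) → EuclideanSpace ℝ (Fin 3)) → ℝ → EuclideanSpace ℝ (Fin 3) → Prop}
    (hQclosed : ∀ (u : ℕ → (ℝ → EuclideanSpace ℝ (Fin 3) → EuclideanSpace ℝ (Fin 3)))
        (W : (ℝ → EuclideanSpace ℝ (Fin 3) → EuclideanSpace ℝ (Fin 3))),
      (∀ j, IsTypeIAncientMild C (u j)) → (∀ j, Q (u j)) → IsTypeIAncientMild C W →
      (∀ n : ℕ, TendstoUniformlyOn (fun j z => u j z.1 z.2) (fun z => W z.1 z.2) atTop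
        (Icc (-((n : ℝ) + 2)) (-(1 / ((n : ℝ) + 2))) ×ˢ
          closedBall (0 : EuclideanSpace ℝ (Fin 3)) ((n : ℝ) + 2))) →
      (∀ t < 0, ∀ x, Tendsto (fun j => u j t x) atTop (𝓝 (W t x))) →
      (∀ t < 0, ∀ x, Tendsto (fun j => fderiv ℝ (u j t) x) atTop (𝓝 (fderiv ℝ (W t) x))) →
      Q W)
    (hGev : ∀ (u : ℕ → (ℝ → EuclideanSpace ℝ (Fin 3) → EuclideanSpace ℝ (Fin 3)))
        (W : (ℝ → EuclideanSpace ℝ (Fin 3) → EuclideanSpace ℝ (Fin 3))) (θ : ℕ → ℝ),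
      (∀ j, IsTypeIAncientMild C (u j)) → IsTypeIAncientMild C W →
      (∀ n : ℕ, TendstoUniformlyOn (fun j z => u j z.1 z.2) (fun z => W z.1 z.2) atTop
        (Icc (-((n : ℝ) + 2)) (-(1 / ((n : ℝ) + 2))) ×ˢ
          closedBall (0 : EuclideanSpace ℝ (Fin 3)) ((n : ℝ) + 2))) →
      (∀ t < 0, ∀ x, Tendsto (fun j => u j t x) atTop (𝓝 (W t x))) →
      (∀ t < 0, ∀ x, Tendsto (fun j => fderiv ℝ (u j t) x) atTop (𝓝 (fderiv ℝ (W t) x))) →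
      Tendsto θ atTop (𝓝 θ₀) →
      ∀ t < 0, ∀ x, ¬ G θ₀ W t x → ∀ᶠ j in atTop, ¬ G (θ j) (u j) t x)
    (hGopen : ∀ (θ : ℝ) (U : (ℝ → EuclideanSpace ℝ (Fin 3) → EuclideanSpace ℝ (Fin 3))),
      IsTypeIAncientMild C U → Q U →
      IsOpen {p : ℝ × EuclideanSpace ℝ (Fin 3) | p.1 < 0 ∧ ¬ G θ U p.1 p.2})
    (hkill : ∀ (W : (ℝ → EuclideanSpace ℝ (Fin 3) → EuclideanSpace ℝ (Fin 3))),
      IsTypeIAncientMild C W →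
      (∀ s : ℝ, s < 0 → ∫⁻ x, ‖fderiv ℝ (W s) x‖ₑ ^ 2 ≤ ENNReal.ofReal (K / Real.sqrt (-s))) →
      Q W → (∀ t : ℝ, -1 < t → t < 0 → ∀ x, G θ₀ W t x) →
      ¬ (∀ r > 0, ∀ M : ℝ, ∃ t ∈ Ioo (-(r ^ 2)) (0 : ℝ),
        ∃ x ∈ ball (0 : EuclideanSpace ℝ (Fin 3)) r, M < ‖W t x‖)) :
    ∃ ε : ℝ, 0 < ε ∧ ε < 1 ∧ ∃ δ : ℝ, 0 < δ ∧ ∃ η : ℝ, 0 < η ∧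
      ∀ (V : (ℝ → EuclideanSpace ℝ (Fin 3) → EuclideanSpace ℝ (Fin 3))), IsTypeIAncientMild C V →
        (∀ s : ℝ, s < 0 → ∫⁻ x, ‖fderiv ℝ (V s) x‖ₑ ^ 2 ≤ ENNReal.ofReal (K / Real.sqrt (-s))) →
        Q V →
        (∀ r > 0, ∀ M : ℝ, ∃ t ∈ Ioo (-(r ^ 2)) (0 : ℝ),
          ∃ x ∈ ball (0 : EuclideanSpace ℝ (Fin 3)) r, M < ‖V t x‖) →
        ENNReal.ofReal η ≤
          volume {p : ℝ × EuclideanSpace ℝ (Fin 3) | p.1 ∈ Icc (-1 : ℝ) (-ε) ∧ ¬ G (θ₀ + δ) V p.1 p.2} := by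
  haveI := isOpenPosMeasure_volume_prod
  by_contra hcon
  push Not at hcon
  -- ## singular members with small windowed violation sets of `G (θ₀ + 1/(j+2))`
  have hsmall : ∀ j : ℕ, ∃ u : (ℝ → EuclideanSpace ℝ (Fin 3) → EuclideanSpace ℝ (Fin 3)),
      IsTypeIAncientMild C u ∧
        (∀ s : ℝ, s < 0 → ∫⁻ x, ‖fderiv ℝ (u s) x‖ₑ ^ 2 ≤ ENNReal.ofReal (K / Real.sqrt (-s))) ∧
        Q u ∧
        (∀ r > 0, ∀ M : ℝ, ∃ t ∈ Ioo (-(r ^ 2)) (0 : ℝ),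
          ∃ x ∈ ball (0 : EuclideanSpace ℝ (Fin 3)) r, M < ‖u t x‖) ∧
        volume {p : ℝ × EuclideanSpace ℝ (Fin 3) |
            p.1 ∈ Icc (-1 : ℝ) (-(1 / ((j : ℝ) + 2))) ∧ ¬ G (θ₀ + 1 / ((j : ℝ) + 2)) u p.1 p.2} <
          ENNReal.ofReal (1 / ((j : ℝ) + 2)) := by
    intro j
    obtain ⟨V, hV, hlaw, hQ, hsing, hvol⟩ := hcon (1 / ((j : ℝ) + 2)) (eps_seq_mem j).1
      (eps_seq_mem j).2 (1 / ((j : ℝ) + 2)) (eps_seq_mem j).1 (1 / ((j : ℝ) + 2)) (eps_seq_mem j).1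
    exact ⟨V, hV, hlaw, hQ, hsing, hvol⟩
  choose u hu hlaw hQu hsu hvol using hsmall
  obtain ⟨ψ, hψ, W, hW, hunif, hpt, hgr⟩ := Compactness.seqLimit hu
  have hψt : Tendsto ψ atTop atTop := hψ.tendsto_atTop
  have hlawW := dissipationLaw_of_tendsto_fderiv (w := fun j => u (ψ j)) (fun j => hlaw (ψ j)) hgr
  have hQW : Q W := hQclosed (fun j => u (ψ j)) W (fun j => hu (ψ j)) (fun j => hQu (ψ j)) hW
    hunif hpt hgr
  have hWsing := Compactness.persistent_singularity_seq (w := fun j => u (ψ j))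
    (fun j => hu _) (fun j => hlaw _) (fun j => hsu _) hW hunif
  -- ## the limit satisfies `G θ₀` on `(−1, 0) × ℝ³`
  have hgoodW : ∀ t : ℝ, -1 < t → t < 0 → ∀ x, G θ₀ W t x := by
    intro t₀ h1 ht₀ x₀
    by_contra hbad
    have hO := hGopen θ₀ W hW hQW
    obtain ⟨δ, hδ, hball⟩ := Metric.isOpen_iff.1 hO (t₀, x₀) ⟨ht₀, hbad⟩
    set δ' : ℝ := min δ (min ((t₀ + 1) / 2) (-t₀ / 2)) with hδ'
    have hδ'pos : 0 < δ' := lt_min hδ (lt_min (by linarith) (by linarith))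
    have hδ'δ : δ' ≤ δ := min_le_left _ _
    have hδ'1 : δ' ≤ (t₀ + 1) / 2 := (min_le_right _ _).trans (min_le_left _ _)
    have hδ'2 : δ' ≤ -t₀ / 2 := (min_le_right _ _).trans (min_le_right _ _)
    set B : Set (ℝ × EuclideanSpace ℝ (Fin 3)) := ball (t₀, x₀) δ' with hB
    have hBpos : 0 < volume B := Metric.measure_ball_pos volume _ hδ'pos
    have hBmem : ∀ p ∈ B, (-1 < p.1 ∧ p.1 < 0) ∧ ¬ G θ₀ W p.1 p.2 := by
      intro p hp
      have hpδ : dist p (t₀, x₀) < δ' := mem_ball.1 hp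
      have hle : dist p.1 t₀ ≤ dist p (t₀, x₀) := by
        rw [Prod.dist_eq]; exact le_max_left _ _
      have ht : dist p.1 t₀ < δ' := lt_of_le_of_lt hle hpδ
      rw [Real.dist_eq] at ht
      have hO' := hball (ball_subset_ball hδ'δ hp)
      refine ⟨⟨?_, ?_⟩, hO'.2⟩
      · have := (abs_lt.1 ht).1; linarith
      · have := (abs_lt.1 ht).2; linarith
    set A : ℕ → Set (ℝ × EuclideanSpace ℝ (Fin 3)) := fun N =>
      {p | ∀ j, N ≤ j → p.1 ∈ Icc (-1 : ℝ) (-(1 / ((ψ j : ℝ) + 2))) ∧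
        ¬ G (θ₀ + 1 / ((ψ j : ℝ) + 2)) (u (ψ j)) p.1 p.2} with hA
    have hBsub : B ⊆ ⋃ N, A N := by
      intro p hp
      obtain ⟨⟨hp1, hp2⟩, hpbad⟩ := hBmem p hp
      have hev := hGev (fun j => u (ψ j)) W (fun j => θ₀ + 1 / ((ψ j : ℝ) + 2)) (fun j => hu _) hW
        hunif hpt hgr (tendsto_theta_seq hψt θ₀) p.1 hp2 p.2 hpbad
      have hev2 : ∀ᶠ j in atTop, (1 : ℝ) / ((ψ j : ℝ) + 2) < -p.1 :=
        (tendsto_eps_seq hψt).eventually (gt_mem_nhds (neg_pos.2 hp2))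
      obtain ⟨N, hN⟩ := eventually_atTop.1 (hev.and hev2)
      refine mem_iUnion.2 ⟨N, fun j hj => ?_⟩
      obtain ⟨hj1, hj2⟩ := hN j hj
      exact ⟨⟨hp1.le, by linarith⟩, hj1⟩
    have hAnull : ∀ N, volume (A N) = 0 := by
      intro N
      by_contra hne
      have hpos : 0 < volume (A N) := pos_iff_ne_zero.2 hne
      have hev3 : ∀ᶠ j in atTop, ENNReal.ofReal (1 / ((ψ j : ℝ) + 2)) < volume (A N) := by
        have h0 : Tendsto (fun j => ENNReal.ofReal (1 / ((ψ j : ℝ) + 2))) atTop (𝓝 0) := by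
          rw [← ENNReal.ofReal_zero]
          exact ENNReal.tendsto_ofReal (tendsto_eps_seq hψt)
        exact h0.eventually (gt_mem_nhds hpos)
      obtain ⟨j, hj1, hj2⟩ := (hev3.and (eventually_ge_atTop N)).exists
      have hsub : A N ⊆ {p : ℝ × EuclideanSpace ℝ (Fin 3) |
          p.1 ∈ Icc (-1 : ℝ) (-(1 / (((ψ j : ℕ) : ℝ) + 2))) ∧
            ¬ G (θ₀ + 1 / (((ψ j : ℕ) : ℝ) + 2)) (u (ψ j)) p.1 p.2} :=
        fun p hp => hp j hj2
      have := (measure_mono hsub).trans_lt (hvol (ψ j))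
      exact lt_irrefl _ (hj1.trans this)
    have hBnull : volume B = 0 := measure_mono_null hBsub (measure_iUnion_null hAnull)
    exact hBpos.ne' hBnull
  exact hkill W hW hlawW hQW hgoodW hWsing

/-! ### The enveloped frame -/

/-- **THE COLLARED WINDOW SOCKET ON THE ENVELOPED FRAME (point form).**
[folklore compactness; cite: KochNadirashviliSereginSverak2009, §4 (arXiv:0709.3599 p. 8)] -/
theorem exists_window_margin_of_apex_kill_envelope {θ₀ : ℝ}
    {G : ℝ → (ℝ → EuclideanSpace ℝ (Fin 3) → EuclideanSpace ℝ (Fin 3)) → ℝ → EuclideanSpace ℝ (Fin 3) → Prop}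
    (hGscale : ∀ (θ : ℝ) (V : (ℝ → EuclideanSpace ℝ (Fin 3) → EuclideanSpace ℝ (Fin 3))) (c t : ℝ)
      (x : EuclideanSpace ℝ (Fin 3)), 0 < c → t < 0 → G θ V (c ^ 2 * t) (c • x) → G θ (nsRescale c V) t x)
    (hGev : ∀ (u : ℕ → (ℝ → EuclideanSpace ℝ (Fin 3) → EuclideanSpace ℝ (Fin 3)))
        (W : (ℝ → EuclideanSpace ℝ (Fin 3) → EuclideanSpace ℝ (Fin 3))) (θ : ℕ → ℝ),
      (∀ j, IsTypeIAncientMild C (u j)) → IsTypeIAncientMild C W →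
      (∀ n : ℕ, TendstoUniformlyOn (fun j z => u j z.1 z.2) (fun z => W z.1 z.2) atTop
        (Icc (-((n : ℝ) + 2)) (-(1 / ((n : ℝ) + 2))) ×ˢ
          closedBall (0 : EuclideanSpace ℝ (Fin 3)) ((n : ℝ) + 2))) →
      (∀ t < 0, ∀ x, Tendsto (fun j => u j t x) atTop (𝓝 (W t x))) →
      (∀ t < 0, ∀ x, Tendsto (fun j => fderiv ℝ (u j t) x) atTop (𝓝 (fderiv ℝ (W t) x))) →
      Tendsto θ atTop (𝓝 θ₀) →
      ∀ t < 0, ∀ x, ¬ G θ₀ W t x → ∀ᶠ j in atTop, ¬ G (θ j) (u j) t x)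
    (hkill : ∀ (W : (ℝ → EuclideanSpace ℝ (Fin 3) → EuclideanSpace ℝ (Fin 3))),
      IsTypeIAncientMild C W → HasTypeIDecay C W → (∀ t : ℝ, -1 < t → t < 0 → ∀ x, G θ₀ W t x) →
      ¬ (∀ r > 0, ∀ M : ℝ, ∃ t ∈ Ioo (-(r ^ 2)) (0 : ℝ),
        ∃ x ∈ ball (0 : EuclideanSpace ℝ (Fin 3)) r, M < ‖W t x‖)) :
    ∃ ε : ℝ, 0 < ε ∧ ε < 1 ∧ ∃ δ : ℝ, 0 < δ ∧
      ∀ (V : (ℝ → EuclideanSpace ℝ (Fin 3) → EuclideanSpace ℝ (Fin 3))), IsTypeIAncientMild C V →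
        HasTypeIDecay C V →
        (∀ r > 0, ∀ M : ℝ, ∃ t ∈ Ioo (-(r ^ 2)) (0 : ℝ),
          ∃ x ∈ ball (0 : EuclideanSpace ℝ (Fin 3)) r, M < ‖V t x‖) →
        ∀ c : ℝ, 0 < c → ∃ t ∈ Icc (-c ^ 2) (-(ε * c ^ 2)), ∃ x : EuclideanSpace ℝ (Fin 3),
          ¬ G (θ₀ + δ) V t x := by
  obtain ⟨K, hK⟩ := exists_uniform_law_of_envelope C
  obtain ⟨ε, hε, hε1, δ, hδ, h⟩ := exists_window_margin_of_apex_kill (C := C) (K := K) (θ₀ := θ₀)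
    (Q := HasTypeIDecay C) (G := G) (fun V c hc hQ => hQ.nsRescale hc)
    (fun u W _ hQu _ _ hpt _ => hasTypeIDecay_of_tendsto hQu hpt) hGscale hGev
    (fun W hW _ hQW hG => hkill W hW hQW hG)
  exact ⟨ε, hε, hε1, δ, hδ, fun V hV hdec hsing c hc => h V hV (hK hV hdec) hdec hsing c hc⟩

/-- **THE COLLARED WINDOW SOCKET ON THE ENVELOPED FRAME (volume form).**
[folklore compactness; cite: KochNadirashviliSereginSverak2009, §4 (arXiv:0709.3599 p. 8)] -/
theorem exists_window_margin_volume_of_apex_kill_envelope {θ₀ : ℝ}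
    {G : ℝ → (ℝ → EuclideanSpace ℝ (Fin 3) → EuclideanSpace ℝ (Fin 3)) → ℝ → EuclideanSpace ℝ (Fin 3) → Prop}
    (hGev : ∀ (u : ℕ → (ℝ → EuclideanSpace ℝ (Fin 3) → EuclideanSpace ℝ (Fin 3)))
        (W : (ℝ → EuclideanSpace ℝ (Fin 3) → EuclideanSpace ℝ (Fin 3))) (θ : ℕ → ℝ),
      (∀ j, IsTypeIAncientMild C (u j)) → IsTypeIAncientMild C W →
      (∀ n : ℕ, TendstoUniformlyOn (fun j z => u j z.1 z.2) (fun z => W z.1 z.2) atTop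
        (Icc (-((n : ℝ) + 2)) (-(1 / ((n : ℝ) + 2))) ×ˢ
          closedBall (0 : EuclideanSpace ℝ (Fin 3)) ((n : ℝ) + 2))) →
      (∀ t < 0, ∀ x, Tendsto (fun j => u j t x) atTop (𝓝 (W t x))) →
      (∀ t < 0, ∀ x, Tendsto (fun j => fderiv ℝ (u j t) x) atTop (𝓝 (fderiv ℝ (W t) x))) →
      Tendsto θ atTop (𝓝 θ₀) →
      ∀ t < 0, ∀ x, ¬ G θ₀ W t x → ∀ᶠ j in atTop, ¬ G (θ j) (u j) t x)
    (hGopen : ∀ (θ : ℝ) (U : (ℝ → EuclideanSpace ℝ (Fin 3) → EuclideanSpace ℝ (Fin 3))),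
      IsTypeIAncientMild C U → HasTypeIDecay C U →
      IsOpen {p : ℝ × EuclideanSpace ℝ (Fin 3) | p.1 < 0 ∧ ¬ G θ U p.1 p.2})
    (hkill : ∀ (W : (ℝ → EuclideanSpace ℝ (Fin 3) → EuclideanSpace ℝ (Fin 3))),
      IsTypeIAncientMild C W → HasTypeIDecay C W → (∀ t : ℝ, -1 < t → t < 0 → ∀ x, G θ₀ W t x) →
      ¬ (∀ r > 0, ∀ M : ℝ, ∃ t ∈ Ioo (-(r ^ 2)) (0 : ℝ),
        ∃ x ∈ ball (0 : EuclideanSpace ℝ (Fin 3)) r, M < ‖W t x‖)) :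
    ∃ ε : ℝ, 0 < ε ∧ ε < 1 ∧ ∃ δ : ℝ, 0 < δ ∧ ∃ η : ℝ, 0 < η ∧
      ∀ (V : (ℝ → EuclideanSpace ℝ (Fin 3) → EuclideanSpace ℝ (Fin 3))), IsTypeIAncientMild C V →
        HasTypeIDecay C V →
        (∀ r > 0, ∀ M : ℝ, ∃ t ∈ Ioo (-(r ^ 2)) (0 : ℝ),
          ∃ x ∈ ball (0 : EuclideanSpace ℝ (Fin 3)) r, M < ‖V t x‖) →
        ENNReal.ofReal η ≤
          volume {p : ℝ × EuclideanSpace ℝ (Fin 3) | p.1 ∈ Icc (-1 : ℝ) (-ε) ∧ ¬ G (θ₀ + δ) V p.1 p.2} := by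
  obtain ⟨K, hK⟩ := exists_uniform_law_of_envelope C
  obtain ⟨ε, hε, hε1, δ, hδ, η, hη, h⟩ := exists_window_margin_volume_of_apex_kill (C := C) (K := K)
    (θ₀ := θ₀) (Q := HasTypeIDecay C) (G := G)
    (fun u W _ hQu _ _ hpt _ => hasTypeIDecay_of_tendsto hQu hpt) hGev hGopen
    (fun W hW _ hQW hG => hkill W hW hQW hG)
  exact ⟨ε, hε, hε1, δ, hδ, η, hη, fun V hV hdec hsing => h V hV (hK hV hdec) hdec hsing⟩

end Summit.NavierStokesRegularity.NavierStokesRegularity.Theorems.FiniteDissipationLiouville.WindowSocket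

end
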